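import Summits.Ventures.FusionMHD.Bench.SAlphaU067Checks3
import HarnessLib

/-!
# F3 — `s–α` at `(s, α) = (1, 67/100)`: even-solution enclosure transcript, KERNEL CHECK FILE 4/4 (stages 45–59: HOE step test ∧ landing,
# one `decide` per stage)
(venture LADDER-GRIDFUSION, rung F3 — the validated-ODE TWIN of the unstable point `(s, α) = (1, 67/100)` of ★ #192 (TT witness):
instability from a kernel-certified SIGN CHANGE of the even solution through lit-3's conjugate-point socket
`Ballooning.SAlpha.exists_unstableWitnessPW3_of_signChange`; cell `gridfusion`, typed by gridfusion-lit-3 (g13), 2026-08-28; generator =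
lit-3's untrusted Lean-interpreter search `scratch/GenSAlphaChain60u.lean`; 0 `def … : Prop` facts, 0 kit jobs, no `native_decide`, no floating
point.  The per-stage facts are stated through `chain.certAt j` / `chain.initAt (j + 1)` (the transcript's own accessors).)
-/

open NonemptyInterval
open Literature.Analysis.ODE Literature.Analysis.ValidatedNumerics Literature.Analysis.ValidatedNumerics.ITaylor

namespace Summit.Ventures.FusionMHD.Bench.SAlphaU067

/-- Stage 45 of the transcript: the elementary HOE step test AND the landing of its end box in the hand-over box of stage 46 — ONE kernel
evaluation. [cite: Moore1979, §8.1 eq. (8.10) with (8.13)] [cite: NedialkovJacksonCorliss1999, §5 Algorithm I] -/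
theorem uok45 : ((chain.certAt 45).check && boxLE (chain.certAt 45).endBox (chain.initAt 46)) = true := by
  decide +kernel

/-- Stage 45 passes the step test. [cite: Moore1979, §8.1 eq. (8.10) with (8.13)] -/
theorem uok45c : (chain.certAt 45).check = true := (Bool.and_eq_true_iff.1 uok45).1

/-- The end box of stage 45 lands in the hand-over box of stage 46. [cite: NedialkovJacksonCorliss1999, §5 Algorithm I] -/
theorem uok45b : boxLE (chain.certAt 45).endBox (chain.initAt 46) = true := (Bool.and_eq_true_iff.1 uok45).2

/-- Stage 46 of the transcript: the elementary HOE step test AND the landing of its end box in the hand-over box of stage 47 — ONE kernel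
evaluation. [cite: Moore1979, §8.1 eq. (8.10) with (8.13)] [cite: NedialkovJacksonCorliss1999, §5 Algorithm I] -/
theorem uok46 : ((chain.certAt 46).check && boxLE (chain.certAt 46).endBox (chain.initAt 47)) = true := by
  decide +kernel

/-- Stage 46 passes the step test. [cite: Moore1979, §8.1 eq. (8.10) with (8.13)] -/
theorem uok46c : (chain.certAt 46).check = true := (Bool.and_eq_true_iff.1 uok46).1

/-- The end box of stage 46 lands in the hand-over box of stage 47. [cite: NedialkovJacksonCorliss1999, §5 Algorithm I] -/
theorem uok46b : boxLE (chain.certAt 46).endBox (chain.initAt 47) = true := (Bool.and_eq_true_iff.1 uok46).2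

/-- Stage 47 of the transcript: the elementary HOE step test AND the landing of its end box in the hand-over box of stage 48 — ONE kernel
evaluation. [cite: Moore1979, §8.1 eq. (8.10) with (8.13)] [cite: NedialkovJacksonCorliss1999, §5 Algorithm I] -/
theorem uok47 : ((chain.certAt 47).check && boxLE (chain.certAt 47).endBox (chain.initAt 48)) = true := by
  decide +kernel

/-- Stage 47 passes the step test. [cite: Moore1979, §8.1 eq. (8.10) with (8.13)] -/
theorem uok47c : (chain.certAt 47).check = true := (Bool.and_eq_true_iff.1 uok47).1

/-- The end box of stage 47 lands in the hand-over box of stage 48. [cite: NedialkovJacksonCorliss1999, §5 Algorithm I] -/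
theorem uok47b : boxLE (chain.certAt 47).endBox (chain.initAt 48) = true := (Bool.and_eq_true_iff.1 uok47).2

/-- Stage 48 of the transcript: the elementary HOE step test AND the landing of its end box in the hand-over box of stage 49 — ONE kernel
evaluation. [cite: Moore1979, §8.1 eq. (8.10) with (8.13)] [cite: NedialkovJacksonCorliss1999, §5 Algorithm I] -/
theorem uok48 : ((chain.certAt 48).check && boxLE (chain.certAt 48).endBox (chain.initAt 49)) = true := by
  decide +kernel

/-- Stage 48 passes the step test. [cite: Moore1979, §8.1 eq. (8.10) with (8.13)] -/
theorem uok48c : (chain.certAt 48).check = true := (Bool.and_eq_true_iff.1 uok48).1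

/-- The end box of stage 48 lands in the hand-over box of stage 49. [cite: NedialkovJacksonCorliss1999, §5 Algorithm I] -/
theorem uok48b : boxLE (chain.certAt 48).endBox (chain.initAt 49) = true := (Bool.and_eq_true_iff.1 uok48).2

/-- Stage 49 of the transcript: the elementary HOE step test AND the landing of its end box in the hand-over box of stage 50 — ONE kernel
evaluation. [cite: Moore1979, §8.1 eq. (8.10) with (8.13)] [cite: NedialkovJacksonCorliss1999, §5 Algorithm I] -/
theorem uok49 : ((chain.certAt 49).check && boxLE (chain.certAt 49).endBox (chain.initAt 50)) = true := by
  decide +kernel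

/-- Stage 49 passes the step test. [cite: Moore1979, §8.1 eq. (8.10) with (8.13)] -/
theorem uok49c : (chain.certAt 49).check = true := (Bool.and_eq_true_iff.1 uok49).1

/-- The end box of stage 49 lands in the hand-over box of stage 50. [cite: NedialkovJacksonCorliss1999, §5 Algorithm I] -/
theorem uok49b : boxLE (chain.certAt 49).endBox (chain.initAt 50) = true := (Bool.and_eq_true_iff.1 uok49).2

/-- Stage 50 of the transcript: the elementary HOE step test AND the landing of its end box in the hand-over box of stage 51 — ONE kernel
evaluation. [cite: Moore1979, §8.1 eq. (8.10) with (8.13)] [cite: NedialkovJacksonCorliss1999, §5 Algorithm I] -/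
theorem uok50 : ((chain.certAt 50).check && boxLE (chain.certAt 50).endBox (chain.initAt 51)) = true := by
  decide +kernel

/-- Stage 50 passes the step test. [cite: Moore1979, §8.1 eq. (8.10) with (8.13)] -/
theorem uok50c : (chain.certAt 50).check = true := (Bool.and_eq_true_iff.1 uok50).1

/-- The end box of stage 50 lands in the hand-over box of stage 51. [cite: NedialkovJacksonCorliss1999, §5 Algorithm I] -/
theorem uok50b : boxLE (chain.certAt 50).endBox (chain.initAt 51) = true := (Bool.and_eq_true_iff.1 uok50).2

/-- Stage 51 of the transcript: the elementary HOE step test AND the landing of its end box in the hand-over box of stage 52 — ONE kernel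
evaluation. [cite: Moore1979, §8.1 eq. (8.10) with (8.13)] [cite: NedialkovJacksonCorliss1999, §5 Algorithm I] -/
theorem uok51 : ((chain.certAt 51).check && boxLE (chain.certAt 51).endBox (chain.initAt 52)) = true := by
  decide +kernel

/-- Stage 51 passes the step test. [cite: Moore1979, §8.1 eq. (8.10) with (8.13)] -/
theorem uok51c : (chain.certAt 51).check = true := (Bool.and_eq_true_iff.1 uok51).1

/-- The end box of stage 51 lands in the hand-over box of stage 52. [cite: NedialkovJacksonCorliss1999, §5 Algorithm I] -/
theorem uok51b : boxLE (chain.certAt 51).endBox (chain.initAt 52) = true := (Bool.and_eq_true_iff.1 uok51).2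

/-- Stage 52 of the transcript: the elementary HOE step test AND the landing of its end box in the hand-over box of stage 53 — ONE kernel
evaluation. [cite: Moore1979, §8.1 eq. (8.10) with (8.13)] [cite: NedialkovJacksonCorliss1999, §5 Algorithm I] -/
theorem uok52 : ((chain.certAt 52).check && boxLE (chain.certAt 52).endBox (chain.initAt 53)) = true := by
  decide +kernel

/-- Stage 52 passes the step test. [cite: Moore1979, §8.1 eq. (8.10) with (8.13)] -/
theorem uok52c : (chain.certAt 52).check = true := (Bool.and_eq_true_iff.1 uok52).1

/-- The end box of stage 52 lands in the hand-over box of stage 53. [cite: NedialkovJacksonCorliss1999, §5 Algorithm I] -/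
theorem uok52b : boxLE (chain.certAt 52).endBox (chain.initAt 53) = true := (Bool.and_eq_true_iff.1 uok52).2

/-- Stage 53 of the transcript: the elementary HOE step test AND the landing of its end box in the hand-over box of stage 54 — ONE kernel
evaluation. [cite: Moore1979, §8.1 eq. (8.10) with (8.13)] [cite: NedialkovJacksonCorliss1999, §5 Algorithm I] -/
theorem uok53 : ((chain.certAt 53).check && boxLE (chain.certAt 53).endBox (chain.initAt 54)) = true := by
  decide +kernel

/-- Stage 53 passes the step test. [cite: Moore1979, §8.1 eq. (8.10) with (8.13)] -/
theorem uok53c : (chain.certAt 53).check = true := (Bool.and_eq_true_iff.1 uok53).1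

/-- The end box of stage 53 lands in the hand-over box of stage 54. [cite: NedialkovJacksonCorliss1999, §5 Algorithm I] -/
theorem uok53b : boxLE (chain.certAt 53).endBox (chain.initAt 54) = true := (Bool.and_eq_true_iff.1 uok53).2

/-- Stage 54 of the transcript: the elementary HOE step test AND the landing of its end box in the hand-over box of stage 55 — ONE kernel
evaluation. [cite: Moore1979, §8.1 eq. (8.10) with (8.13)] [cite: NedialkovJacksonCorliss1999, §5 Algorithm I] -/
theorem uok54 : ((chain.certAt 54).check && boxLE (chain.certAt 54).endBox (chain.initAt 55)) = true := by
  decide +kernel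

/-- Stage 54 passes the step test. [cite: Moore1979, §8.1 eq. (8.10) with (8.13)] -/
theorem uok54c : (chain.certAt 54).check = true := (Bool.and_eq_true_iff.1 uok54).1

/-- The end box of stage 54 lands in the hand-over box of stage 55. [cite: NedialkovJacksonCorliss1999, §5 Algorithm I] -/
theorem uok54b : boxLE (chain.certAt 54).endBox (chain.initAt 55) = true := (Bool.and_eq_true_iff.1 uok54).2

/-- Stage 55 of the transcript: the elementary HOE step test AND the landing of its end box in the hand-over box of stage 56 — ONE kernel
evaluation. [cite: Moore1979, §8.1 eq. (8.10) with (8.13)] [cite: NedialkovJacksonCorliss1999, §5 Algorithm I] -/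
theorem uok55 : ((chain.certAt 55).check && boxLE (chain.certAt 55).endBox (chain.initAt 56)) = true := by
  decide +kernel

/-- Stage 55 passes the step test. [cite: Moore1979, §8.1 eq. (8.10) with (8.13)] -/
theorem uok55c : (chain.certAt 55).check = true := (Bool.and_eq_true_iff.1 uok55).1

/-- The end box of stage 55 lands in the hand-over box of stage 56. [cite: NedialkovJacksonCorliss1999, §5 Algorithm I] -/
theorem uok55b : boxLE (chain.certAt 55).endBox (chain.initAt 56) = true := (Bool.and_eq_true_iff.1 uok55).2

/-- Stage 56 of the transcript: the elementary HOE step test AND the landing of its end box in the hand-over box of stage 57 — ONE kernel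
evaluation. [cite: Moore1979, §8.1 eq. (8.10) with (8.13)] [cite: NedialkovJacksonCorliss1999, §5 Algorithm I] -/
theorem uok56 : ((chain.certAt 56).check && boxLE (chain.certAt 56).endBox (chain.initAt 57)) = true := by
  decide +kernel

/-- Stage 56 passes the step test. [cite: Moore1979, §8.1 eq. (8.10) with (8.13)] -/
theorem uok56c : (chain.certAt 56).check = true := (Bool.and_eq_true_iff.1 uok56).1

/-- The end box of stage 56 lands in the hand-over box of stage 57. [cite: NedialkovJacksonCorliss1999, §5 Algorithm I] -/
theorem uok56b : boxLE (chain.certAt 56).endBox (chain.initAt 57) = true := (Bool.and_eq_true_iff.1 uok56).2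

/-- Stage 57 of the transcript: the elementary HOE step test AND the landing of its end box in the hand-over box of stage 58 — ONE kernel
evaluation. [cite: Moore1979, §8.1 eq. (8.10) with (8.13)] [cite: NedialkovJacksonCorliss1999, §5 Algorithm I] -/
theorem uok57 : ((chain.certAt 57).check && boxLE (chain.certAt 57).endBox (chain.initAt 58)) = true := by
  decide +kernel

/-- Stage 57 passes the step test. [cite: Moore1979, §8.1 eq. (8.10) with (8.13)] -/
theorem uok57c : (chain.certAt 57).check = true := (Bool.and_eq_true_iff.1 uok57).1

/-- The end box of stage 57 lands in the hand-over box of stage 58. [cite: NedialkovJacksonCorliss1999, §5 Algorithm I] -/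
theorem uok57b : boxLE (chain.certAt 57).endBox (chain.initAt 58) = true := (Bool.and_eq_true_iff.1 uok57).2

/-- Stage 58 of the transcript: the elementary HOE step test AND the landing of its end box in the hand-over box of stage 59 — ONE kernel
evaluation. [cite: Moore1979, §8.1 eq. (8.10) with (8.13)] [cite: NedialkovJacksonCorliss1999, §5 Algorithm I] -/
theorem uok58 : ((chain.certAt 58).check && boxLE (chain.certAt 58).endBox (chain.initAt 59)) = true := by
  decide +kernel

/-- Stage 58 passes the step test. [cite: Moore1979, §8.1 eq. (8.10) with (8.13)] -/
theorem uok58c : (chain.certAt 58).check = true := (Bool.and_eq_true_iff.1 uok58).1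

/-- The end box of stage 58 lands in the hand-over box of stage 59. [cite: NedialkovJacksonCorliss1999, §5 Algorithm I] -/
theorem uok58b : boxLE (chain.certAt 58).endBox (chain.initAt 59) = true := (Bool.and_eq_true_iff.1 uok58).2

/-- Stage 59 of the transcript: the elementary HOE step test AND the landing of its end box in the final box (`initAt 60 = final`) — ONE kernel
evaluation. [cite: Moore1979, §8.1 eq. (8.10) with (8.13)] [cite: NedialkovJacksonCorliss1999, §5 Algorithm I] -/
theorem uok59 : ((chain.certAt 59).check && boxLE (chain.certAt 59).endBox (chain.initAt 60)) = true := by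
  decide +kernel

/-- Stage 59 passes the step test. [cite: Moore1979, §8.1 eq. (8.10) with (8.13)] -/
theorem uok59c : (chain.certAt 59).check = true := (Bool.and_eq_true_iff.1 uok59).1

/-- The end box of stage 59 lands in the final box (`initAt 60 = final`). [cite: NedialkovJacksonCorliss1999, §5 Algorithm I] -/
theorem uok59b : boxLE (chain.certAt 59).endBox (chain.initAt 60) = true := (Bool.and_eq_true_iff.1 uok59).2

end Summit.Ventures.FusionMHD.Bench.SAlphaU067
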